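import Summits.Parity.GeneralizedHardyLittlewood.Theorems.BeyondDiagonalBeatsQuarter.MellinBumpWindows
import Summits.Parity.GeneralizedHardyLittlewood.Theorems.BeyondDiagonalBeatsQuarter.MellinBumpCoprimeC1
import HarnessLib

/-!
# Route `PrimeLevelFamEdge`, crux K_B (stmt-Parity-20343), line `diagonal_kernel_split` rev 4, plan Ω —
# **the phase / complex-window / dyadic-window LAYERS of C1 for ARBITRARY coefficient arrays**, and their
# instance for the coprimality-restricted (divisor-layer) mollifier weights (I5 ∘ I2a of the a8P-closable total)

`mellinBump_xsq_e(_complex)` and `MellinBumpWindows` dress the real Mellin-bump bound (`mellinBump_xsq_bv`) with a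
complex phase, a complex window and a window decomposition; they are hard-wired to the weights `x_m/m`. The divisor
layers need the same dressing on top of `MellinBumpCoprimeC1.mellinBump_coprime_bv` (weights `𝟙[(m,d_i)=1]W(m)λ_{M_i}(m)`).
Here the layers are proved ONCE for arbitrary real coefficient arrays `u₁, u₂` and an abstract C1 bound
`E K B Y` (hypothesis `hC1`: every `K`-Lipschitz real window supported in `[a,b]` with `|h| ≤ B` gives
`|Σ u₁(m₁)u₂(m₂)h(m₁m₂/Y)| ≤ E K B Y`):

* §1 `lipschitz_mul_cos'`/`_sin'` (the lead's private lemmas, exported), `abs_sum_mul_cos_le_of_C1`/`_sin_`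
  (phase: `K ↦ K + 2π|Θ|B`), **`norm_sum_window_e_le_of_C1`** (complex window `G` and complex phase:
  `‖Σ (u₁u₂ : ℂ)·G(m₁m₂/Y)·e(Θm₁m₂/Y)‖ ≤ 4·E (K + 2π|Θ|B) B Y`);
* §2 **`norm_sum_windows_le_of_C1`** (generic window decomposition, profile `ρ`, scales `λ_j`, per-window data) and
  **`norm_sum_dyadicWindows_le_of_C1`** (`ρ = dyadicBump`, `λ_j = 2^j/Y`);
* §3 the divisor-layer instance **`norm_sum_coprime_dyadicWindows_le`**: `u_i = 𝟙[(·,d_i)=1]W·λ_{M_i}`,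
  `E K B Y = D(c^{ω(d₁)}+c^{ω(d₂)})(2(2B+K(b−a))(1+|log b|)+4K√(bY)/Y)/(1+log Y)^k`.

Theorems only; standard axioms. Helper toward `stub_offDiagBelowSlack_io`; closes nothing.
«The programme SEARCHES and TYPES; no claim about Landau–Siegel zeros, Theorems 1–2 of arXiv:2211.02515 or
a repaired Margin232 until a kernel theorem says so.»
-/

noncomputable section

open Real Complex Finset
open scoped FourierTransform

namespace Summit.Parity.GeneralizedHardyLittlewood.Theorems.BeyondDiagonalBeatsQuarter.OffDiag

open Literature.Analysis.Calculus.WhitneyConvex (dyadicBump dyadicBump_nonneg dyadicBump_le_one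
  mem_Ioo_of_dyadicBump_ne_zero)
open Literature.NumberTheory.LFunctions.KMV2000.MollifierMainTerm (W)
open MellinBump (logWeight mellinBump_coprime_bv)

/-! ### §1. Phase and complex window on top of an abstract C1 bound -/

/-- A `K`-Lipschitz function bounded by `B` times a `2π|Θ|`-frequency cosine is `(K + 2π|Θ|B)`-Lipschitz.
[folklore] -/
theorem lipschitz_mul_cos' {h : ℝ → ℝ} {K B Θ : ℝ} (hLip : ∀ x y, |h x - h y| ≤ K * |x - y|)
    (hB : ∀ y, |h y| ≤ B) (x y : ℝ) :
    |h x * Real.cos (2 * π * Θ * x) - h y * Real.cos (2 * π * Θ * y)| ≤ (K + 2 * π * |Θ| * B) * |x - y| := by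
  have hcos : |Real.cos (2 * π * Θ * x) - Real.cos (2 * π * Θ * y)| ≤ 2 * π * |Θ| * |x - y| := by
    have h1 := Real.lipschitzWith_cos.dist_le_mul (2 * π * Θ * x) (2 * π * Θ * y)
    rw [Real.dist_eq, Real.dist_eq, NNReal.coe_one, one_mul] at h1
    calc |Real.cos (2 * π * Θ * x) - Real.cos (2 * π * Θ * y)| ≤ |2 * π * Θ * x - 2 * π * Θ * y| := h1
      _ = 2 * π * |Θ| * |x - y| := by
          rw [← mul_sub, abs_mul, abs_mul, abs_of_pos Real.two_pi_pos]
  have hB0 : 0 ≤ B := (abs_nonneg _).trans (hB 0)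
  calc |h x * Real.cos (2 * π * Θ * x) - h y * Real.cos (2 * π * Θ * y)|
      = |(h x - h y) * Real.cos (2 * π * Θ * x) +
          h y * (Real.cos (2 * π * Θ * x) - Real.cos (2 * π * Θ * y))| := by ring_nf
    _ ≤ |(h x - h y) * Real.cos (2 * π * Θ * x)| +
          |h y * (Real.cos (2 * π * Θ * x) - Real.cos (2 * π * Θ * y))| := abs_add_le _ _
    _ ≤ K * |x - y| * 1 + B * (2 * π * |Θ| * |x - y|) := by
        rw [abs_mul, abs_mul]
        exact add_le_add (mul_le_mul (hLip x y) (Real.abs_cos_le_one _) (abs_nonneg _)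
            (le_trans (abs_nonneg _) (hLip x y)))
          (mul_le_mul (hB y) hcos (abs_nonneg _) hB0)
    _ = (K + 2 * π * |Θ| * B) * |x - y| := by ring

/-- The sine twin of `lipschitz_mul_cos'`. [folklore] -/
theorem lipschitz_mul_sin' {h : ℝ → ℝ} {K B Θ : ℝ} (hLip : ∀ x y, |h x - h y| ≤ K * |x - y|)
    (hB : ∀ y, |h y| ≤ B) (x y : ℝ) :
    |h x * Real.sin (2 * π * Θ * x) - h y * Real.sin (2 * π * Θ * y)| ≤ (K + 2 * π * |Θ| * B) * |x - y| := by
  have hsin : |Real.sin (2 * π * Θ * x) - Real.sin (2 * π * Θ * y)| ≤ 2 * π * |Θ| * |x - y| := by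
    have h1 := Real.lipschitzWith_sin.dist_le_mul (2 * π * Θ * x) (2 * π * Θ * y)
    rw [Real.dist_eq, Real.dist_eq, NNReal.coe_one, one_mul] at h1
    calc |Real.sin (2 * π * Θ * x) - Real.sin (2 * π * Θ * y)| ≤ |2 * π * Θ * x - 2 * π * Θ * y| := h1
      _ = 2 * π * |Θ| * |x - y| := by
          rw [← mul_sub, abs_mul, abs_mul, abs_of_pos Real.two_pi_pos]
  have hB0 : 0 ≤ B := (abs_nonneg _).trans (hB 0)
  calc |h x * Real.sin (2 * π * Θ * x) - h y * Real.sin (2 * π * Θ * y)|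
      = |(h x - h y) * Real.sin (2 * π * Θ * x) +
          h y * (Real.sin (2 * π * Θ * x) - Real.sin (2 * π * Θ * y))| := by ring_nf
    _ ≤ |(h x - h y) * Real.sin (2 * π * Θ * x)| +
          |h y * (Real.sin (2 * π * Θ * x) - Real.sin (2 * π * Θ * y))| := abs_add_le _ _
    _ ≤ K * |x - y| * 1 + B * (2 * π * |Θ| * |x - y|) := by
        rw [abs_mul, abs_mul]
        exact add_le_add (mul_le_mul (hLip x y) (Real.abs_sin_le_one _) (abs_nonneg _)
            (le_trans (abs_nonneg _) (hLip x y)))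
          (mul_le_mul (hB y) hsin (abs_nonneg _) hB0)
    _ = (K + 2 * π * |Θ| * B) * |x - y| := by ring


section Layers

variable {u₁ u₂ : ℕ → ℝ} {N₁ N₂ : ℕ} {a b : ℝ} {E : ℝ → ℝ → ℝ → ℝ}

/-- The abstract C1 hypothesis: every `K`-Lipschitz real window supported in `[a,b]` with `|h| ≤ B`, read at scale
`Y ≥ 1`, gives `|Σ u₁(m₁)u₂(m₂)h(m₁m₂/Y)| ≤ E K B Y`. (A `Prop`-valued abbreviation local to this section would be a
definition; we spell the hypothesis out in each statement.) -/
theorem abs_sum_mul_cos_le_of_C1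
    (hC1 : ∀ (K B Y : ℝ) (h : ℝ → ℝ), 0 ≤ K → 1 ≤ Y → (∀ x y, |h x - h y| ≤ K * |x - y|) →
      (∀ y, h y ≠ 0 → a ≤ y ∧ y ≤ b) → (∀ y, |h y| ≤ B) →
      |∑ m₁ ∈ Icc 1 N₁, ∑ m₂ ∈ Icc 1 N₂, u₁ m₁ * u₂ m₂ * h ((m₁ : ℝ) * m₂ / Y)| ≤ E K B Y)
    {K B Y : ℝ} (Θ : ℝ) (hK : 0 ≤ K) (hY : 1 ≤ Y) (h : ℝ → ℝ) (hLip : ∀ x y, |h x - h y| ≤ K * |x - y|)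
    (hsupp : ∀ y, h y ≠ 0 → a ≤ y ∧ y ≤ b) (hB : ∀ y, |h y| ≤ B) :
    |∑ m₁ ∈ Icc 1 N₁, ∑ m₂ ∈ Icc 1 N₂,
        u₁ m₁ * u₂ m₂ * (h ((m₁ : ℝ) * m₂ / Y) * Real.cos (2 * π * Θ * ((m₁ : ℝ) * m₂ / Y)))| ≤
      E (K + 2 * π * |Θ| * B) B Y := by
  have hB0 : 0 ≤ B := (abs_nonneg _).trans (hB 0)
  refine hC1 (K + 2 * π * |Θ| * B) B Y (fun y ↦ h y * Real.cos (2 * π * Θ * y)) (by positivity) hY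
    (fun x y ↦ lipschitz_mul_cos' hLip hB x y) ?_ ?_
  · intro y hy
    exact hsupp y (left_ne_zero_of_mul hy)
  · intro y
    rw [abs_mul]
    exact le_trans (mul_le_of_le_one_right (abs_nonneg _) (Real.abs_cos_le_one _)) (hB y)

/-- The sine twin of `abs_sum_mul_cos_le_of_C1`. [folklore] -/
theorem abs_sum_mul_sin_le_of_C1
    (hC1 : ∀ (K B Y : ℝ) (h : ℝ → ℝ), 0 ≤ K → 1 ≤ Y → (∀ x y, |h x - h y| ≤ K * |x - y|) →
      (∀ y, h y ≠ 0 → a ≤ y ∧ y ≤ b) → (∀ y, |h y| ≤ B) →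
      |∑ m₁ ∈ Icc 1 N₁, ∑ m₂ ∈ Icc 1 N₂, u₁ m₁ * u₂ m₂ * h ((m₁ : ℝ) * m₂ / Y)| ≤ E K B Y)
    {K B Y : ℝ} (Θ : ℝ) (hK : 0 ≤ K) (hY : 1 ≤ Y) (h : ℝ → ℝ) (hLip : ∀ x y, |h x - h y| ≤ K * |x - y|)
    (hsupp : ∀ y, h y ≠ 0 → a ≤ y ∧ y ≤ b) (hB : ∀ y, |h y| ≤ B) :
    |∑ m₁ ∈ Icc 1 N₁, ∑ m₂ ∈ Icc 1 N₂,
        u₁ m₁ * u₂ m₂ * (h ((m₁ : ℝ) * m₂ / Y) * Real.sin (2 * π * Θ * ((m₁ : ℝ) * m₂ / Y)))| ≤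
      E (K + 2 * π * |Θ| * B) B Y := by
  have hB0 : 0 ≤ B := (abs_nonneg _).trans (hB 0)
  refine hC1 (K + 2 * π * |Θ| * B) B Y (fun y ↦ h y * Real.sin (2 * π * Θ * y)) (by positivity) hY
    (fun x y ↦ lipschitz_mul_sin' hLip hB x y) ?_ ?_
  · intro y hy
    exact hsupp y (left_ne_zero_of_mul hy)
  · intro y
    rw [abs_mul]
    exact le_trans (mul_le_of_le_one_right (abs_nonneg _) (Real.abs_sin_le_one _)) (hB y)

/-- **Complex window and complex phase on top of an abstract C1 bound.** For `G : ℝ → ℂ` with `‖G x − G y‖ ≤ K|x−y|`,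
supported in `[a,b]`, `‖G‖ ≤ B`, and `Y ≥ 1`:
`‖Σ (u₁(m₁)u₂(m₂) : ℂ)·G(m₁m₂/Y)·e(Θm₁m₂/Y)‖ ≤ 4·E (K + 2π|Θ|B) B Y`
(`G·e = (G_r cos − G_i sin) + i(G_r sin + G_i cos)`, four real windows). [folklore] -/
theorem norm_sum_window_e_le_of_C1
    (hC1 : ∀ (K B Y : ℝ) (h : ℝ → ℝ), 0 ≤ K → 1 ≤ Y → (∀ x y, |h x - h y| ≤ K * |x - y|) →
      (∀ y, h y ≠ 0 → a ≤ y ∧ y ≤ b) → (∀ y, |h y| ≤ B) →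
      |∑ m₁ ∈ Icc 1 N₁, ∑ m₂ ∈ Icc 1 N₂, u₁ m₁ * u₂ m₂ * h ((m₁ : ℝ) * m₂ / Y)| ≤ E K B Y)
    {K B Y : ℝ} (Θ : ℝ) (hK : 0 ≤ K) (hY : 1 ≤ Y) (G : ℝ → ℂ) (hLip : ∀ x y, ‖G x - G y‖ ≤ K * |x - y|)
    (hsupp : ∀ y, G y ≠ 0 → a ≤ y ∧ y ≤ b) (hB : ∀ y, ‖G y‖ ≤ B) :
    ‖∑ m₁ ∈ Icc 1 N₁, ∑ m₂ ∈ Icc 1 N₂,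
        ((u₁ m₁ * u₂ m₂ : ℝ) : ℂ) * G ((m₁ : ℝ) * m₂ / Y) * (𝐞 (Θ * ((m₁ : ℝ) * m₂ / Y)) : ℂ)‖ ≤
      4 * E (K + 2 * π * |Θ| * B) B Y := by
  -- the two real windows
  have hre_Lip : ∀ x y, |(G x).re - (G y).re| ≤ K * |x - y| := fun x y ↦ by
    rw [← Complex.sub_re]; exact (Complex.abs_re_le_norm _).trans (hLip x y)
  have him_Lip : ∀ x y, |(G x).im - (G y).im| ≤ K * |x - y| := fun x y ↦ by
    rw [← Complex.sub_im]; exact (Complex.abs_im_le_norm _).trans (hLip x y)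
  have hre_supp : ∀ y, (G y).re ≠ 0 → a ≤ y ∧ y ≤ b :=
    fun y hy ↦ hsupp y fun h0 ↦ hy (by rw [h0, Complex.zero_re])
  have him_supp : ∀ y, (G y).im ≠ 0 → a ≤ y ∧ y ≤ b :=
    fun y hy ↦ hsupp y fun h0 ↦ hy (by rw [h0, Complex.zero_im])
  have hre_B : ∀ y, |(G y).re| ≤ B := fun y ↦ (Complex.abs_re_le_norm _).trans (hB y)
  have him_B : ∀ y, |(G y).im| ≤ B := fun y ↦ (Complex.abs_im_le_norm _).trans (hB y)
  -- the four real sums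
  set Src : ℝ := ∑ m₁ ∈ Icc 1 N₁, ∑ m₂ ∈ Icc 1 N₂,
    u₁ m₁ * u₂ m₂ * ((G ((m₁ : ℝ) * m₂ / Y)).re * Real.cos (2 * π * Θ * ((m₁ : ℝ) * m₂ / Y))) with hSrc
  set Sis : ℝ := ∑ m₁ ∈ Icc 1 N₁, ∑ m₂ ∈ Icc 1 N₂,
    u₁ m₁ * u₂ m₂ * ((G ((m₁ : ℝ) * m₂ / Y)).im * Real.sin (2 * π * Θ * ((m₁ : ℝ) * m₂ / Y))) with hSis
  set Srs : ℝ := ∑ m₁ ∈ Icc 1 N₁, ∑ m₂ ∈ Icc 1 N₂,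
    u₁ m₁ * u₂ m₂ * ((G ((m₁ : ℝ) * m₂ / Y)).re * Real.sin (2 * π * Θ * ((m₁ : ℝ) * m₂ / Y))) with hSrs
  set Sic : ℝ := ∑ m₁ ∈ Icc 1 N₁, ∑ m₂ ∈ Icc 1 N₂,
    u₁ m₁ * u₂ m₂ * ((G ((m₁ : ℝ) * m₂ / Y)).im * Real.cos (2 * π * Θ * ((m₁ : ℝ) * m₂ / Y))) with hSic
  have h1 := abs_sum_mul_cos_le_of_C1 hC1 Θ hK hY (fun y ↦ (G y).re) hre_Lip hre_supp hre_B
  have h2 := abs_sum_mul_sin_le_of_C1 hC1 Θ hK hY (fun y ↦ (G y).im) him_Lip him_supp him_B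
  have h3 := abs_sum_mul_sin_le_of_C1 hC1 Θ hK hY (fun y ↦ (G y).re) hre_Lip hre_supp hre_B
  have h4 := abs_sum_mul_cos_le_of_C1 hC1 Θ hK hY (fun y ↦ (G y).im) him_Lip him_supp him_B
  have hsplit : ∑ m₁ ∈ Icc 1 N₁, ∑ m₂ ∈ Icc 1 N₂,
      ((u₁ m₁ * u₂ m₂ : ℝ) : ℂ) * G ((m₁ : ℝ) * m₂ / Y) * (𝐞 (Θ * ((m₁ : ℝ) * m₂ / Y)) : ℂ) =
      ((Src - Sis : ℝ) : ℂ) + ((Srs + Sic : ℝ) : ℂ) * I := by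
    rw [hSrc, hSis, hSrs, hSic, Complex.ofReal_sub, Complex.ofReal_add]
    simp only [Complex.ofReal_sum]
    rw [← Finset.sum_sub_distrib, ← Finset.sum_add_distrib, Finset.sum_mul, ← Finset.sum_add_distrib]
    refine Finset.sum_congr rfl fun m₁ _ ↦ ?_
    rw [← Finset.sum_sub_distrib, ← Finset.sum_add_distrib, Finset.sum_mul, ← Finset.sum_add_distrib]
    refine Finset.sum_congr rfl fun m₂ _ ↦ ?_
    rw [fourierChar_coe_eq_cos_add_sin, show 2 * π * (Θ * ((m₁ : ℝ) * m₂ / Y)) =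
      2 * π * Θ * ((m₁ : ℝ) * m₂ / Y) by ring]
    apply Complex.ext
    · simp only [Complex.mul_re, Complex.mul_im, Complex.add_re, Complex.add_im, Complex.sub_re,
        Complex.ofReal_re, Complex.ofReal_im, Complex.I_re, Complex.I_im]
      ring
    · simp only [Complex.mul_re, Complex.mul_im, Complex.add_re, Complex.add_im,
        Complex.sub_im, Complex.ofReal_re, Complex.ofReal_im, Complex.I_re, Complex.I_im]
      ring
  rw [hsplit]
  calc ‖((Src - Sis : ℝ) : ℂ) + ((Srs + Sic : ℝ) : ℂ) * I‖
      ≤ ‖((Src - Sis : ℝ) : ℂ)‖ + ‖((Srs + Sic : ℝ) : ℂ) * I‖ := norm_add_le _ _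
    _ = |Src - Sis| + |Srs + Sic| := by
        rw [norm_mul, Complex.norm_I, mul_one, Complex.norm_real, Complex.norm_real, Real.norm_eq_abs,
          Real.norm_eq_abs]
    _ ≤ (|Src| + |Sis|) + (|Srs| + |Sic|) := add_le_add (abs_sub _ _) (abs_add_le _ _)
    _ ≤ (E (K + 2 * π * |Θ| * B) B Y + E (K + 2 * π * |Θ| * B) B Y) +
          (E (K + 2 * π * |Θ| * B) B Y + E (K + 2 * π * |Θ| * B) B Y) :=
        add_le_add (add_le_add h1 h2) (add_le_add h3 h4)
    _ = 4 * E (K + 2 * π * |Θ| * B) B Y := by ring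

/-! ### §2. Window decompositions on top of an abstract C1 bound -/

/-- **Window decomposition (generic profile and scales) on top of an abstract C1 bound.** As
`norm_sum_xsq_windows_le`, for arbitrary coefficient arrays: with a profile `ρ` (`K_ρ`-Lipschitz, `|ρ| ≤ 1`,
supported in `[a,b]`), scales `λ_j > 0` with `Yλ_j ≥ 1` and `Σ_j ρ((m₁m₂/Y)/λ_j) = 1` at sampled products with
`G ≠ 0`, per-window data `B_j ≥ ‖G‖`, `K_j ≥ Lip G` on `[λ_j a, λ_j b]`:
`‖Σ (u₁u₂ : ℂ)·G(m₁m₂/Y)·e(Θm₁m₂/Y)‖ ≤ Σ_j 4·E (K_ρB_j + λ_jK_j + 2π|Θλ_j|B_j) B_j (Yλ_j)`. [folklore] -/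
theorem norm_sum_windows_le_of_C1
    (hC1 : ∀ (K B Y : ℝ) (h : ℝ → ℝ), 0 ≤ K → 1 ≤ Y → (∀ x y, |h x - h y| ≤ K * |x - y|) →
      (∀ y, h y ≠ 0 → a ≤ y ∧ y ≤ b) → (∀ y, |h y| ≤ B) →
      |∑ m₁ ∈ Icc 1 N₁, ∑ m₂ ∈ Icc 1 N₂, u₁ m₁ * u₂ m₂ * h ((m₁ : ℝ) * m₂ / Y)| ≤ E K B Y)
    {ι : Type} (J : Finset ι) (lam : ι → ℝ) {Kρ : ℝ} (ρ : ℝ → ℝ) (hKρ : 0 ≤ Kρ)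
    (hρLip : ∀ x y, |ρ x - ρ y| ≤ Kρ * |x - y|) (hρsupp : ∀ y, ρ y ≠ 0 → a ≤ y ∧ y ≤ b) (hρ1 : ∀ y, |ρ y| ≤ 1)
    (G : ℝ → ℂ) (Θ Y : ℝ) (hY : 0 < Y) (hlam : ∀ j ∈ J, 0 < lam j ∧ 1 ≤ Y * lam j)
    (hpart : ∀ m₁ ∈ Icc 1 N₁, ∀ m₂ ∈ Icc 1 N₂, G ((m₁ : ℝ) * m₂ / Y) ≠ 0 →
      ∑ j ∈ J, ρ ((m₁ : ℝ) * m₂ / Y / lam j) = 1)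
    (Bw Kw : ι → ℝ) (hBK : ∀ j ∈ J, 0 ≤ Bw j ∧ 0 ≤ Kw j)
    (hGB : ∀ j ∈ J, ∀ y, lam j * a ≤ y → y ≤ lam j * b → ‖G y‖ ≤ Bw j)
    (hGLip : ∀ j ∈ J, ∀ x y, lam j * a ≤ x → x ≤ lam j * b → lam j * a ≤ y → y ≤ lam j * b →
      ‖G x - G y‖ ≤ Kw j * |x - y|) :
    ‖∑ m₁ ∈ Icc 1 N₁, ∑ m₂ ∈ Icc 1 N₂,
        ((u₁ m₁ * u₂ m₂ : ℝ) : ℂ) * G ((m₁ : ℝ) * m₂ / Y) * (𝐞 (Θ * ((m₁ : ℝ) * m₂ / Y)) : ℂ)‖ ≤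
      ∑ j ∈ J, 4 * E ((Kρ * Bw j + lam j * Kw j) + 2 * π * |Θ * lam j| * Bw j) (Bw j) (Y * lam j) := by
  set h : ι → ℝ → ℂ := fun j s ↦ (ρ s : ℂ) * G (lam j * s) with hh
  have hsplit : ∑ m₁ ∈ Icc 1 N₁, ∑ m₂ ∈ Icc 1 N₂,
      ((u₁ m₁ * u₂ m₂ : ℝ) : ℂ) * G ((m₁ : ℝ) * m₂ / Y) * (𝐞 (Θ * ((m₁ : ℝ) * m₂ / Y)) : ℂ) =
      ∑ j ∈ J, ∑ m₁ ∈ Icc 1 N₁, ∑ m₂ ∈ Icc 1 N₂,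
        ((u₁ m₁ * u₂ m₂ : ℝ) : ℂ) * h j ((m₁ : ℝ) * m₂ / (Y * lam j)) *
          (𝐞 ((Θ * lam j) * ((m₁ : ℝ) * m₂ / (Y * lam j))) : ℂ) := by
    symm
    refine (Finset.sum_comm.trans (Finset.sum_congr rfl fun m₁ _ ↦ Finset.sum_comm)).trans ?_
    refine Finset.sum_congr rfl fun m₁ hm₁ ↦ Finset.sum_congr rfl fun m₂ hm₂ ↦ ?_
    have hterm : ∀ j ∈ J, ((u₁ m₁ * u₂ m₂ : ℝ) : ℂ) * h j ((m₁ : ℝ) * m₂ / (Y * lam j)) *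
        (𝐞 ((Θ * lam j) * ((m₁ : ℝ) * m₂ / (Y * lam j))) : ℂ) =
        (ρ ((m₁ : ℝ) * m₂ / Y / lam j) : ℂ) * (((u₁ m₁ * u₂ m₂ : ℝ) : ℂ) *
          G ((m₁ : ℝ) * m₂ / Y) * (𝐞 (Θ * ((m₁ : ℝ) * m₂ / Y)) : ℂ)) := by
      intro j hj
      have hl : lam j ≠ 0 := (hlam j hj).1.ne'
      have e1 : (m₁ : ℝ) * m₂ / (Y * lam j) = (m₁ : ℝ) * m₂ / Y / lam j := by rw [div_div]
      have e2 : lam j * ((m₁ : ℝ) * m₂ / (Y * lam j)) = (m₁ : ℝ) * m₂ / Y := by field_simp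
      have e3 : (Θ * lam j) * ((m₁ : ℝ) * m₂ / (Y * lam j)) = Θ * ((m₁ : ℝ) * m₂ / Y) := by field_simp
      simp only [hh, e2, e3]
      rw [e1]
      ring
    rw [Finset.sum_congr rfl hterm, ← Finset.sum_mul]
    by_cases hG : G ((m₁ : ℝ) * m₂ / Y) = 0
    · simp [hG]
    · have hp := hpart m₁ hm₁ m₂ hm₂ hG
      have hpc : ∑ j ∈ J, (ρ ((m₁ : ℝ) * m₂ / Y / lam j) : ℂ) = 1 := by exact_mod_cast hp
      rw [hpc, one_mul]
  rw [hsplit]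
  refine (norm_sum_le _ _).trans (Finset.sum_le_sum fun j hj ↦ ?_)
  obtain ⟨hl0, hYl⟩ := hlam j hj
  obtain ⟨hB0, hK0⟩ := hBK j hj
  have hwin : ∀ s, a ≤ s → s ≤ b → lam j * a ≤ lam j * s ∧ lam j * s ≤ lam j * b := fun s h1 h2 ↦
    ⟨mul_le_mul_of_nonneg_left h1 hl0.le, mul_le_mul_of_nonneg_left h2 hl0.le⟩
  have hLip : ∀ x y, ‖h j x - h j y‖ ≤ (Kρ * Bw j + lam j * Kw j) * |x - y| := by
    intro x y
    refine lipschitz_ofReal_mul_window (G := fun s ↦ G (lam j * s)) hρLip hρsupp hρ1 hKρ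
      (mul_nonneg hl0.le hK0) hB0
      (fun s h1 h2 ↦ hGB j hj _ (hwin s h1 h2).1 (hwin s h1 h2).2) ?_ x y
    intro x' y' hx1 hx2 hy1 hy2
    have h := hGLip j hj (lam j * x') (lam j * y') (hwin x' hx1 hx2).1 (hwin x' hx1 hx2).2
      (hwin y' hy1 hy2).1 (hwin y' hy1 hy2).2
    rw [← mul_sub, abs_mul, abs_of_pos hl0] at h
    linarith [h]
  have hsupp : ∀ s, h j s ≠ 0 → a ≤ s ∧ s ≤ b := fun s hs ↦
    hρsupp s fun h0 ↦ hs (by simp only [hh, h0, Complex.ofReal_zero, zero_mul])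
  have hbound : ∀ s, ‖h j s‖ ≤ Bw j := by
    intro s
    by_cases hs : a ≤ s ∧ s ≤ b
    · simp only [hh, norm_mul, Complex.norm_real, Real.norm_eq_abs]
      calc |ρ s| * ‖G (lam j * s)‖ ≤ 1 * Bw j :=
            mul_le_mul (hρ1 s) (hGB j hj _ (hwin s hs.1 hs.2).1 (hwin s hs.1 hs.2).2) (norm_nonneg _) zero_le_one
        _ = Bw j := one_mul _
    · have h0 : ρ s = 0 := by by_contra h0; exact hs (hρsupp s h0)
      simp only [hh, h0, Complex.ofReal_zero, zero_mul, norm_zero]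
      exact hB0
  exact norm_sum_window_e_le_of_C1 hC1 (Θ * lam j) (add_nonneg (mul_nonneg hKρ hB0) (mul_nonneg hl0.le hK0))
    hYl (h j) hLip hsupp hbound

/-- **Dyadic window decomposition on top of an abstract C1 bound** (`ρ = dyadicBump`, `λ_j = 2^j/Y`, `j < N`
with `N₁N₂ ≤ 2^N/2`): `‖Σ (u₁u₂ : ℂ)·G(m₁m₂/Y)·e(Θm₁m₂/Y)‖ ≤ Σ_{j<N} 4·E (KθB_j + (2^j/Y)K_j + 2π|Θ2^j/Y|B_j) B_j 2^j`
for the Lipschitz constant `Kθ` of `dyadicBump` (`exists_lipschitz_dyadicBump`) and per-window data on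
`[2^j/(2Y), 2^{j+1}/Y]`. [folklore] -/
theorem norm_sum_dyadicWindows_le_of_C1
    (hC1 : ∀ (K B Y : ℝ) (h : ℝ → ℝ), 0 ≤ K → 1 ≤ Y → (∀ x y, |h x - h y| ≤ K * |x - y|) →
      (∀ y, h y ≠ 0 → (1 / 2 : ℝ) ≤ y ∧ y ≤ 2) → (∀ y, |h y| ≤ B) →
      |∑ m₁ ∈ Icc 1 N₁, ∑ m₂ ∈ Icc 1 N₂, u₁ m₁ * u₂ m₂ * h ((m₁ : ℝ) * m₂ / Y)| ≤ E K B Y)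
    {Kθ : ℝ} (hKθ : 0 ≤ Kθ) (hθLip : ∀ x y, |dyadicBump x - dyadicBump y| ≤ Kθ * |x - y|)
    (G : ℝ → ℂ) (Θ Y : ℝ) (hY : 0 < Y) (N : ℕ) (hN : ((N₁ : ℝ) * N₂) ≤ 2 ^ N / 2)
    (Bw Kw : ℕ → ℝ) (hBK : ∀ j ∈ Finset.range N, 0 ≤ Bw j ∧ 0 ≤ Kw j)
    (hGB : ∀ j ∈ Finset.range N, ∀ y, 2 ^ j / Y * (1 / 2) ≤ y → y ≤ 2 ^ j / Y * 2 → ‖G y‖ ≤ Bw j)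
    (hGLip : ∀ j ∈ Finset.range N, ∀ x y, 2 ^ j / Y * (1 / 2) ≤ x → x ≤ 2 ^ j / Y * 2 →
      2 ^ j / Y * (1 / 2) ≤ y → y ≤ 2 ^ j / Y * 2 → ‖G x - G y‖ ≤ Kw j * |x - y|) :
    ‖∑ m₁ ∈ Icc 1 N₁, ∑ m₂ ∈ Icc 1 N₂,
        ((u₁ m₁ * u₂ m₂ : ℝ) : ℂ) * G ((m₁ : ℝ) * m₂ / Y) * (𝐞 (Θ * ((m₁ : ℝ) * m₂ / Y)) : ℂ)‖ ≤
      ∑ j ∈ Finset.range N, 4 * E ((Kθ * Bw j + 2 ^ j / Y * Kw j) + 2 * π * |Θ * (2 ^ j / Y)| * Bw j) (Bw j)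
        ((2 : ℝ) ^ j) := by
  have h := norm_sum_windows_le_of_C1 hC1 (Finset.range N) (fun j ↦ (2 : ℝ) ^ j / Y) dyadicBump hKθ hθLip
    (fun y hy ↦ let hm := mem_Ioo_of_dyadicBump_ne_zero hy; ⟨hm.1.le, hm.2.le⟩)
    (fun y ↦ by rw [abs_of_nonneg (dyadicBump_nonneg y)]; exact dyadicBump_le_one y)
    G Θ Y hY ?_ ?_ Bw Kw hBK hGB hGLip
  · have e : ∀ j : ℕ, Y * ((2 : ℝ) ^ j / Y) = (2 : ℝ) ^ j := fun j ↦ by field_simp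
    simp only [e] at h
    exact h
  · intro j _
    refine ⟨by positivity, ?_⟩
    rw [mul_div_cancel₀ _ hY.ne']
    exact one_le_pow₀ (by norm_num)
  · intro m₁ hm₁ m₂ hm₂ _
    have h1 : (1 : ℝ) ≤ (m₁ : ℝ) * m₂ := by
      have a1 : (1 : ℝ) ≤ m₁ := by exact_mod_cast (Finset.mem_Icc.1 hm₁).1
      have a2 : (1 : ℝ) ≤ m₂ := by exact_mod_cast (Finset.mem_Icc.1 hm₂).1
      nlinarith
    have h2 : (m₁ : ℝ) * m₂ ≤ 2 ^ N / 2 := by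
      have a1 : (m₁ : ℝ) ≤ N₁ := by exact_mod_cast (Finset.mem_Icc.1 hm₁).2
      have a2 : (m₂ : ℝ) ≤ N₂ := by exact_mod_cast (Finset.mem_Icc.1 hm₂).2
      have a0 : (0 : ℝ) ≤ m₁ := by positivity
      have a3 : (0 : ℝ) ≤ N₂ := by positivity
      nlinarith
    have hp := sum_range_dyadicBump_div_two_pow h1 h2
    refine Eq.trans (Finset.sum_congr rfl fun j _ ↦ ?_) hp
    congr 1
    field_simp

end Layers

/-! ### §3. The divisor-layer instance -/

/-- **C1 with dyadic windows, complex window and phase, for the coprimality-restricted mollifier weights**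
(`u_i(m) = 𝟙[(m,d_i)=1]W(m)λ_{M_i}(m)`): for every `k`, with the constants `D, c` of `mellinBump_coprime_bv k (1/2)`
and the Lipschitz constant `Kθ` of `dyadicBump`: for `d₁,d₂ ≥ 1`, `M₁,M₂ > 1`, `Y > 0`, `N` with
`⌊M₁⌋⌊M₂⌋ ≤ 2^N/2`, a window `G : ℝ → ℂ` with per-dyadic-window sup/Lipschitz data `(B_j, K_j)`:
`‖Σ (u₁u₂ : ℂ)·G(m₁m₂/Y)·e(Θm₁m₂/Y)‖ ≤ Σ_{j<N} 4·D(c^{ω(d₁)}+c^{ω(d₂)})·X_j/(1 + log 2^j)^k`,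
`X_j = 2(2B_j + K′_j·(3/2))(1+|log 2|) + 4K′_j√(2·2^j)/2^j`, `K′_j = KθB_j + (2^j/Y)K_j + 2π|Θ2^j/Y|B_j`. [folklore] -/
theorem norm_sum_coprime_dyadicWindows_le (k : ℕ) :
    ∃ D c Kθ : ℝ, 0 < D ∧ 1 ≤ c ∧ 0 ≤ Kθ ∧ ∀ (d₁ d₂ : ℕ), 1 ≤ d₁ → 1 ≤ d₂ →
      ∀ (M₁ M₂ : ℝ), 1 < M₁ → 1 < M₂ → ∀ (G : ℝ → ℂ) (Θ Y : ℝ) (N : ℕ), 0 < Y →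
      ((⌊M₁⌋₊ : ℝ) * ⌊M₂⌋₊) ≤ 2 ^ N / 2 →
      ∀ (Bw Kw : ℕ → ℝ), (∀ j ∈ Finset.range N, 0 ≤ Bw j ∧ 0 ≤ Kw j) →
      (∀ j ∈ Finset.range N, ∀ y, 2 ^ j / Y * (1 / 2) ≤ y → y ≤ 2 ^ j / Y * 2 → ‖G y‖ ≤ Bw j) →
      (∀ j ∈ Finset.range N, ∀ x y, 2 ^ j / Y * (1 / 2) ≤ x → x ≤ 2 ^ j / Y * 2 →
        2 ^ j / Y * (1 / 2) ≤ y → y ≤ 2 ^ j / Y * 2 → ‖G x - G y‖ ≤ Kw j * |x - y|) →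
        ‖∑ m₁ ∈ Icc 1 ⌊M₁⌋₊, ∑ m₂ ∈ Icc 1 ⌊M₂⌋₊,
            ((((if m₁.Coprime d₁ then W m₁ else 0) * logWeight M₁ m₁) *
              ((if m₂.Coprime d₂ then W m₂ else 0) * logWeight M₂ m₂) : ℝ) : ℂ) *
              G ((m₁ : ℝ) * m₂ / Y) * (𝐞 (Θ * ((m₁ : ℝ) * m₂ / Y)) : ℂ)‖ ≤
          ∑ j ∈ Finset.range N, 4 * (D * (c ^ d₁.primeFactors.card + c ^ d₂.primeFactors.card) *
            (2 * ((2 * Bw j + ((Kθ * Bw j + 2 ^ j / Y * Kw j) + 2 * π * |Θ * (2 ^ j / Y)| * Bw j) *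
              (2 - 1 / 2)) * (1 + |Real.log 2|)) +
              4 * ((Kθ * Bw j + 2 ^ j / Y * Kw j) + 2 * π * |Θ * (2 ^ j / Y)| * Bw j) *
                (Real.sqrt (2 * (2 : ℝ) ^ j) / (2 : ℝ) ^ j)) / (1 + Real.log ((2 : ℝ) ^ j)) ^ k) := by
  obtain ⟨D, c, hD, hc, hmain⟩ := mellinBump_coprime_bv k (by norm_num : (0 : ℝ) < 1 / 2)
  obtain ⟨Kθ, hKθ, hθLip⟩ := exists_lipschitz_dyadicBump
  refine ⟨D, c, Kθ, hD, hc, hKθ, ?_⟩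
  intro d₁ d₂ hd₁ hd₂ M₁ M₂ hM₁ hM₂ G Θ Y N hY hN Bw Kw hBK hGB hGLip
  -- the abstract C1 bound for these weights
  have hC1 : ∀ (K B Y' : ℝ) (h : ℝ → ℝ), 0 ≤ K → 1 ≤ Y' → (∀ x y, |h x - h y| ≤ K * |x - y|) →
      (∀ y, h y ≠ 0 → (1 / 2 : ℝ) ≤ y ∧ y ≤ 2) → (∀ y, |h y| ≤ B) →
      |∑ m₁ ∈ Icc 1 ⌊M₁⌋₊, ∑ m₂ ∈ Icc 1 ⌊M₂⌋₊,
        ((if m₁.Coprime d₁ then W m₁ else 0) * logWeight M₁ m₁) *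
          ((if m₂.Coprime d₂ then W m₂ else 0) * logWeight M₂ m₂) * h ((m₁ : ℝ) * m₂ / Y')| ≤
      D * (c ^ d₁.primeFactors.card + c ^ d₂.primeFactors.card) *
        (2 * ((2 * B + K * (2 - 1 / 2)) * (1 + |Real.log 2|)) + 4 * K * (Real.sqrt (2 * Y') / Y')) /
          (1 + Real.log Y') ^ k := by
    intro K B Y' h hK hY' hLip hsupp hB
    exact hmain d₁ d₂ hd₁ hd₂ (1 / 2) 2 K B le_rfl (by norm_num) hK h hLip hsupp hB M₁ M₂ hM₁ hM₂ Y' hY'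
  exact norm_sum_dyadicWindows_le_of_C1 (u₁ := fun m ↦ (if m.Coprime d₁ then W m else 0) * logWeight M₁ m)
    (u₂ := fun m ↦ (if m.Coprime d₂ then W m else 0) * logWeight M₂ m)
    (E := fun K B Y' ↦ D * (c ^ d₁.primeFactors.card + c ^ d₂.primeFactors.card) *
        (2 * ((2 * B + K * (2 - 1 / 2)) * (1 + |Real.log 2|)) + 4 * K * (Real.sqrt (2 * Y') / Y')) /
          (1 + Real.log Y') ^ k)
    hC1 hKθ hθLip G Θ Y hY N hN Bw Kw hBK hGB hGLip

end Summit.Parity.GeneralizedHardyLittlewood.Theorems.BeyondDiagonalBeatsQuarter.OffDiag
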